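import Literature.NumberTheory.EllipticCurves.BhargavaHo2022.SelmerTwoAverage
import Literature.NumberTheory.EllipticCurves.BhargavaHo2022.LargeFamilyCount
import Literature.NumberTheory.EllipticCurves.BSDWave0Proofs
import Summits.BirchSwinnertonDyer.Rank2.F2DensityAlgebra
import HarnessLib

/-!
# BirchSwinnertonDyer / CountingDoorF2AtThree — what the ONE orbit count on `F₂` that exists in print
# (Bhargava–Ho, `avg #Sel₂ ≤ 12` on every large subfamily; tree fact `thm1_2_F2_selmerTwo`) yields for the
# rank distribution of every large `Φ ⊆ F₂`: Thm 1.3(`F₂`) «limsup avg rank ≤ 7/2» RE-DERIVED BY NAME,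
# the tail bounds «dens{rank ≥ k} ≤ 12/2^k», and — with Thm 9.1/10.1 — «rank ∈ {2, 3} for at least a third»

Route `route-BirchSwinnertonDyer-CountingDoorF2AtThree` (cell bsd-rank2; TWIN leaf
`PAdicBSDRankTwoPositiveProportion`; deciding crux I1 `SelmerThreeAverageLargeF2` =
stmt-BirchSwinnertonDyer-19440: «avg #Sel₃ ≤ 36 on every large `Φ ⊆ F₂`», the MISSING `(F₂, 3)` orbit
count). Seat bsd-rank2-sel3-p2 GEN 5 (width-lever lane B on I1, road «orbit counting restricted to
`F₂`»). ROUTE-FREE module (imports only Literature + `Rank2.F2DensityAlgebra`): the printed-input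
counterpart of the I1 levers `…SelmerAverageRankMoment` (p582870, I1 ⇒ `avg 3^rank ≤ 36`),
`…SelmerAverageRankFourShare` (p596004, eng-2: I1 ⇒ `dens{rank ≥ 4} ≤ 7/16`, `≤ 3/8` with the floor) and
`…SelmerAverageRankMean` (p597998, eng-2: I1 ⇒ `avg rank ≤ 19/6`); the dedup split of 2026-08-28T02:33Z
(HOME/STATUS) assigns the `2`-Selmer / printed side to this seat.

THE PRINTED ORBIT COUNT AND ITS RANK COROLLARIES. Bhargava–Ho 2022 count `2 ⊗ 2 ⊗ 2 ⊗ 2` hypercubes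
(Thm 1.1(g) + Thm 1.2): «the average size of the 2-Selmer group in `F₂` is at most `12` … even when one
averages over any large subfamily» — vendored as the named fact
`Literature.NumberTheory.EllipticCurves.BhargavaHo2022.thm1_2_F2_selmerTwo` (p563006) — and state
(Thm 1.3) «we obtain the explicit bound … `7/2` for the limsup of the average ranks of the curves in any
large subfamily of `F₂`». With `2^{rank} ≤ #Sel₂` (Silverman X.4.2, tree theorem
`WeierstrassCurve.pow_rank_le_card_selmerGroup`) three pointwise integer inequalities turn the fact into
rank statements on every large `Φ`, all proved here MODULO THAT FACT ONLY (§5):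

* `8r ≤ 2^r + 16` (chord through `r = 3, 4`) ⇒ **Thm 1.3(`F₂`): `limsup avg rank ≤ 12/8 + 2 = 7/2`**
  (`averageRank_le_seven_halves_of_selmerTwoAverage`) — the printed clause DERIVED, never to be vendored;
  `7/2` is the LP optimum of the method (`dens{rank 3} = dens{rank 4} = 1/2` has `avg 2^rank = 12`).
* `2^k·1_{rank ≥ k} ≤ 2^{rank}` ⇒ **`limsup dens{rank ≥ k} ≤ 12/2^k`** for every `k`
  (`rankTailShare_le_of_selmerTwoAverage`; `k = 4`: `3/4`, `k = 5`: `3/8`, `k = 6`: `3/16`).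
* `12·1_{rank ≥ 4} ≤ 2^{rank} − 4·1_{rank ≥ 2}` ⇒ with the generic floor «rank ≥ 2 for 100 %» (Thm 10.1
  transported to large `Φ` by Thm 9.1: facts `thm10_1_F2`, `thm9_1_F2`, tree corollary
  `thm9_1_F2.hasDensityOn_torsionOrder_rank_of_isLarge`): **`limsup dens{rank ≥ 4} ≤ (12 − 4)/12 = 2/3`**
  and hence **`liminf dens{rank ∈ {2, 3}} ≥ 1/3`** on every large `Φ` with nonempty residue sets
  (`rankFourShare_le_two_thirds_of_facts`, `densityOnGE_rank_two_or_three_of_facts`) — the sharpest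
  statement about the rank TAIL of `F₂` that the printed orbit count supports (Markov on Thm 1.3 gives
  only `dens{rank ≥ 4} ≤ 3/4`). Rank EXACTLY `2` for a positive proportion is NOT reachable this way
  (the level `#Sel₂ = 8` absorbs any first moment; see `…WeakLeafAtTwo`, input Y₂) — that is the leaf.

COMPARISON WITH THE I1 LEVERS (conditional on the open crux, `(F₂, 3)`): `avg rank ≤ 19/6` vs `7/2`
here; `dens{rank ≥ 4} ≤ 3/8` vs `2/3` here. INSTRUMENT (cell data of record,
`HOME/bsd-rank2-sel3-p2/data/rankmoment/`, kit j296636 + j297123, full samples, PARI `ellrank` with the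
marked points, `r = R` on all but `≤ 2.5·10⁻⁴`; WINDOW averages over generic members of `F₂`):
`[10¹³,10¹⁴)` (`n = 119 758`) / `[10¹⁴,10¹⁵)` (`n = 79 912`): avg rank `3.117 / 3.147` (printed cap `3.5`,
I1 cap `3.167`); `dens{rank ≥ 4} = .305 / .317` (printed cap `.667`, I1 cap `.375`); `dens{rank ∈ {2,3}}
= .695 / .683` (printed floor `.333`); `dens{rank ≥ 5} = .059 / .067` (printed cap `.375`); per class
`a mod 3` (81 large families) at `[10¹⁴,10¹⁵)`: avg rank `2.89 … 3.31` (above `7/2` on `0/81`, above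
`19/6` on `49/81`). Every printed bound holds with room at finite height; the I1 bounds are grazed or
crossed — calibration only (limsup statements; GEN 3/4 memos).

Contents: §1 integer inequalities (`eight_mul_le_two_pow_add`, `two_pow_mul_indicator_le_two_pow`,
`twelve_mul_indicator_le_two_pow_sub`); §2 averaging algebra (`averageOn_affine_le`,
`averageOnLE_affine`, `averageOn_linear₂`); §3 member-wise (`two_pow_mordellWeilRank_le_natCard_selmerTwo`,
`mordellWeilRank_le_selmerTwo_affine`, `indicator_rank_ge_le_selmerTwo`,
`indicator_rankFour_le_selmerTwo_sub_floor`); §4 on any `Φ` from `Φ.AverageOnLE #Sel₂ c`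
(`averageRank_le_of_selmerTwoAverageLE`, `rankTailShare_le_of_selmerTwoAverageLE`,
`rankFourShare_le_of_selmerTwoAverageLE_of_floor`, `densityOnGE_rank_two_or_three_of_selmerTwoAverageLE_of_floor`);
§5 BY NAME from the facts (`averageRank_le_seven_halves_of_selmerTwoAverage` = BH Thm 1.3(`F₂`),
`…_all`, `rankTailShare_le_of_selmerTwoAverage`, `rankFourShare_le_two_thirds_of_facts`,
`densityOnGE_rank_two_or_three_of_facts`, `…_all`).

HONESTY. Every theorem of §5 is CONDITIONAL on named Literature facts — PRINTED theorems of
Bhargava–Ho (Thm 1.1(g)/1.2; Thm 9.1; Thm 10.1) whose hypercube count / sieve is not formalised; the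
gate records them as conditional results. Nothing here bears on I1 except as calibration; nothing reads
an analytic rank (B1); no S0 motion; rank `= 2` for a positive proportion is NOT proved; BSD is not
proved by any of this. THEOREMS ONLY: no definition, no new named fact, no `sorry`; standard axioms.
PARTITION: none — r_an ≥ 2, summit axis S0 (D-0036(1) funded rung); TWIN (D-0056): n/a.

References: M. Bhargava, W. Ho, arXiv:2207.03309 (2022), Thm. 1.1(g), 1.2, 1.3 (p. 2–3), Thm. 9.1
(§9.1), Thm. 10.1 (§10) [BhargavaHo2022]; J. Silverman, AEC X.4.2 [SilvermanAEC2009]; M. Bhargava,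
A. Shankar, Ann. of Math. 181 (2015) §1 (the `F₀` prototype `2r ≤ 2^r`, tree
`mordellWeilRank_le_half_card_selmerTwo`) [BhargavaShankarAnnals2015]; B. Poonen, E. Rains, J. AMS 25
(2012) (model values `12 = 2²·3`, mean rank `5/2`) [PoonenRains2012].
-/

set_option linter.dupNamespace false

noncomputable section

open scoped Classical
open Filter Topology Finset
open WeierstrassCurve Literature.NumberTheory.EllipticCurves
  Literature.NumberTheory.EllipticCurves.BhargavaHo2022
  Summit.BirchSwinnertonDyer.Rank2

namespace Summit.BirchSwinnertonDyer.BirchSwinnertonDyer.Theorems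

variable (Φ : CongruenceFamily₂)

/-! ### §1 Integer inequalities -/

/-- `8 r ≤ 2^r + 16` for every natural number `r` (the chord of `r ↦ 2^r` through `r = 3, 4`, where
equality holds) — the inequality that turns «avg #Sel₂ ≤ 12» into «avg rank ≤ 7/2» in Bhargava–Ho's
Thm 1.3. [cite: BhargavaHo2022, Thm. 1.3 (deduction from Thm. 1.1/1.2)] -/
theorem eight_mul_le_two_pow_add (r : ℕ) : 8 * r ≤ 2 ^ r + 16 := by
  induction r with
  | zero => simp
  | succ n ih =>
    rcases lt_or_ge n 3 with h | h
    · interval_cases n <;> norm_num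
    · have h2 : 2 ^ (n + 1) = 2 * 2 ^ n := by rw [pow_succ, mul_comm]
      rw [h2]
      generalize 2 ^ n = t at ih ⊢
      omega

/-- `2^k · 1_{k ≤ r} ≤ 2^r` (real form). [folklore] -/
theorem two_pow_mul_indicator_le_two_pow (k r : ℕ) :
    (2 : ℝ) ^ k * (if k ≤ r then (1 : ℝ) else 0) ≤ (2 : ℝ) ^ r := by
  split_ifs with h
  · rw [mul_one]
    exact pow_le_pow_right₀ (by norm_num) h
  · rw [mul_zero]
    positivity

/-- With the floor indicator: `12 · 1_{4 ≤ r} ≤ 2^r − 4 · 1_{2 ≤ r}` for every `r : ℕ`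
(`r ≥ 4`: `12 ≤ 2^r − 4`; `r = 2, 3`: `0 ≤ 2^r − 4`; `r ≤ 1`: `0 ≤ 2^r`). [folklore] -/
theorem twelve_mul_indicator_le_two_pow_sub (r : ℕ) :
    12 * (if 4 ≤ r then (1 : ℝ) else 0) ≤
      (2 : ℝ) ^ r - 4 * (if 2 ≤ r then (1 : ℝ) else 0) := by
  by_cases h4 : 4 ≤ r
  · have h2 : 2 ≤ r := le_trans (by norm_num) h4
    rw [if_pos h4, if_pos h2]
    have h16 : (2 : ℝ) ^ 4 ≤ (2 : ℝ) ^ r := pow_le_pow_right₀ (by norm_num) h4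
    norm_num at h16 ⊢
    linarith
  · rw [if_neg h4, mul_zero]
    by_cases h2 : 2 ≤ r
    · rw [if_pos h2, mul_one]
      have h4' : (2 : ℝ) ^ 2 ≤ (2 : ℝ) ^ r := pow_le_pow_right₀ (by norm_num) h2
      norm_num at h4' ⊢
      linarith
    · rw [if_neg h2, mul_zero, sub_zero]
      positivity

/-! ### §2 Averaging algebra over height balls -/

/-- For `β ≥ 0`: `avg_{Φ(<X)} (α f + β) ≤ α · avg_{Φ(<X)} f + β` (equality on a nonempty height ball; the
vocabulary's junk value `0` on an empty ball makes it an inequality). [folklore] -/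
theorem averageOn_affine_le (f : Params → ℝ) (α : ℝ) {β : ℝ} (hβ : 0 ≤ β) (X : ℕ) :
    Φ.averageOn (fun a ↦ α * f a + β) X ≤ α * Φ.averageOn f X + β := by
  rw [averageOn_eq_sum_div, averageOn_eq_sum_div]
  rcases Nat.eq_zero_or_pos (Φ.below X).card with h0 | hpos
  · rw [Finset.card_eq_zero.mp h0]
    simp [hβ]
  · have hc : (0 : ℝ) < ((Φ.below X).card : ℝ) := by exact_mod_cast hpos
    have hsum : (∑ a ∈ Φ.below X, (α * f a + β)) =
        α * (∑ a ∈ Φ.below X, f a) + ((Φ.below X).card : ℝ) * β := by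
      rw [Finset.sum_add_distrib, Finset.sum_const, nsmul_eq_mul, Finset.mul_sum]
    rw [hsum, add_div, mul_div_assoc, mul_div_cancel_left₀ β hc.ne']

/-- `limsup avg f ≤ c` and `α, β ≥ 0` give `limsup avg (α f + β) ≤ α c + β` (ε-forms). [folklore] -/
theorem averageOnLE_affine {f : Params → ℝ} {c α β : ℝ} (hf : Φ.AverageOnLE f c) (hα : 0 ≤ α)
    (hβ : 0 ≤ β) : Φ.AverageOnLE (fun a ↦ α * f a + β) (α * c + β) := by
  intro ε hε
  have hε' : 0 < ε / (α + 1) := div_pos hε (by linarith)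
  filter_upwards [hf (ε / (α + 1)) hε'] with X hX
  refine (averageOn_affine_le Φ f α hβ X).trans ?_
  have h1 : α * Φ.averageOn f X ≤ α * (c + ε / (α + 1)) := mul_le_mul_of_nonneg_left hX hα
  have h2 : α * (ε / (α + 1)) ≤ ε := by
    rw [mul_div_assoc']
    exact (div_le_iff₀ (by linarith)).2 (by nlinarith)
  linarith [h1, h2, mul_add α c (ε / (α + 1))]

/-- Averages are linear in the integrand (two terms, no constant; valid also on an empty ball).
[folklore] -/
theorem averageOn_linear₂ (f g : Params → ℝ) (α γ : ℝ) (X : ℕ) :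
    Φ.averageOn (fun a ↦ α * f a + γ * g a) X = α * Φ.averageOn f X + γ * Φ.averageOn g X := by
  rw [averageOn_eq_sum_div, averageOn_eq_sum_div, averageOn_eq_sum_div, Finset.sum_add_distrib,
    ← Finset.mul_sum, ← Finset.mul_sum, add_div, mul_div_assoc, mul_div_assoc]

/-! ### §3 Member-wise: the rank against the `2`-Selmer size -/

/-- For every member `a` of `F₂`: `2^{rank E_a(ℚ)} ≤ #Sel₂(E_a)` (Kummer sequence, Silverman X.4.2; tree
theorem `WeierstrassCurve.pow_rank_le_card_selmerGroup`), as real numbers. [cite: SilvermanAEC2009, Thm X.4.2] -/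
theorem two_pow_mordellWeilRank_le_natCard_selmerTwo (a : Params) (ha : a.IsMember) :
    (2 : ℝ) ^ a.curve.mordellWeilRank ≤ (Nat.card (a.curve.selmerGroup 2) : ℝ) := by
  haveI := Params.isElliptic_curve ha
  have h := a.curve.pow_rank_le_card_selmerGroup (n := 2) (by norm_num)
  simp only [Nat.cast_ofNat] at h
  exact_mod_cast h

/-- For every member `a` of `F₂`: `rank E_a(ℚ) ≤ #Sel₂(E_a)/8 + 2` — the member-wise step of Bhargava–Ho's
Thm 1.3. [cite: SilvermanAEC2009, Thm X.4.2; BhargavaHo2022, Thm. 1.3] -/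
theorem mordellWeilRank_le_selmerTwo_affine (a : Params) (ha : a.IsMember) :
    (a.curve.mordellWeilRank : ℝ) ≤ (1 / 8) * (Nat.card (a.curve.selmerGroup 2) : ℝ) + 2 := by
  have h₁ : (8 : ℝ) * a.curve.mordellWeilRank ≤ (2 : ℝ) ^ a.curve.mordellWeilRank + 16 := by
    exact_mod_cast eight_mul_le_two_pow_add a.curve.mordellWeilRank
  have h₂ := two_pow_mordellWeilRank_le_natCard_selmerTwo a ha
  linarith

/-- For every member `a` of `F₂` and every `k`: `1_{rank E_a ≥ k} ≤ #Sel₂(E_a)/2^k`.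
[cite: SilvermanAEC2009, Thm X.4.2] -/
theorem indicator_rank_ge_le_selmerTwo (k : ℕ) (a : Params) (ha : a.IsMember) :
    (if k ≤ a.curve.mordellWeilRank then (1 : ℝ) else 0) ≤
      (1 / (2 : ℝ) ^ k) * (Nat.card (a.curve.selmerGroup 2) : ℝ) + 0 := by
  have h₁ := two_pow_mul_indicator_le_two_pow k a.curve.mordellWeilRank
  have h₂ := two_pow_mordellWeilRank_le_natCard_selmerTwo a ha
  have hk : (0 : ℝ) < (2 : ℝ) ^ k := by positivity
  rw [add_zero, one_div, le_inv_mul_iff₀ hk]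
  exact h₁.trans h₂

/-- For every member `a` of `F₂`: `1_{rank ≥ 4} ≤ #Sel₂(E_a)/12 − 1_{rank ≥ 2}/3` (the level `#Sel₂ ≥ 16`
against the floor `#Sel₂ ≥ 4` on rank `≥ 2`). [cite: SilvermanAEC2009, Thm X.4.2] -/
theorem indicator_rankFour_le_selmerTwo_sub_floor (a : Params) (ha : a.IsMember) :
    (if 4 ≤ a.curve.mordellWeilRank then (1 : ℝ) else 0) ≤
      (1 / 12) * (Nat.card (a.curve.selmerGroup 2) : ℝ) +
        (-(1 / 3)) * (if 2 ≤ a.curve.mordellWeilRank then (1 : ℝ) else 0) := by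
  have h₁ := twelve_mul_indicator_le_two_pow_sub a.curve.mordellWeilRank
  have h₂ := two_pow_mordellWeilRank_le_natCard_selmerTwo a ha
  linarith

/-! ### §4 On any subfamily: consequences of `limsup avg #Sel₂ ≤ c` -/

/-- On any subfamily `Φ ⊆ F₂` and for any constant `c`: `limsup avg #Sel₂ ≤ c ⇒ limsup avg rank ≤ c/8 + 2`
(ε-forms). [cite: SilvermanAEC2009, Thm X.4.2; BhargavaHo2022, Thm. 1.3] -/
theorem averageRank_le_of_selmerTwoAverageLE {c : ℝ}
    (h : Φ.AverageOnLE (fun a ↦ (Nat.card (a.curve.selmerGroup 2) : ℝ)) c) :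
    Φ.AverageOnLE (fun a ↦ (a.curve.mordellWeilRank : ℝ)) (c / 8 + 2) := by
  have h' := averageOnLE_affine Φ (α := 1 / 8) (β := 2) h (by norm_num) (by norm_num)
  have hc : (1 / 8 : ℝ) * c + 2 = c / 8 + 2 := by ring
  rw [hc] at h'
  exact averageOnLE_mono Φ h' fun a ha ↦ mordellWeilRank_le_selmerTwo_affine a ha.1

/-- On any subfamily `Φ ⊆ F₂`, any constant `c` and any `k`: `limsup avg #Sel₂ ≤ c ⇒` the proportion of
members of rank `≥ k` is eventually `≤ c/2^k + ε` (upper density `≤ c/2^k`). [cite: SilvermanAEC2009, Thm X.4.2] -/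
theorem rankTailShare_le_of_selmerTwoAverageLE {c : ℝ} (k : ℕ)
    (h : Φ.AverageOnLE (fun a ↦ (Nat.card (a.curve.selmerGroup 2) : ℝ)) c) {ε : ℝ} (hε : 0 < ε) :
    ∀ᶠ X : ℕ in atTop, Φ.proportionOn (fun a ↦ k ≤ a.curve.mordellWeilRank) X ≤ c / 2 ^ k + ε := by
  have hk : (0 : ℝ) ≤ 1 / (2 : ℝ) ^ k := by positivity
  have h' := averageOnLE_affine Φ (α := 1 / (2 : ℝ) ^ k) (β := 0) h hk le_rfl
  have h'' := averageOnLE_mono Φ h' fun a ha ↦ indicator_rank_ge_le_selmerTwo k a ha.1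
  refine (h'' ε hε).mono fun X hX ↦ ?_
  rw [proportionOn_eq_averageOn]
  have hc : 1 / (2 : ℝ) ^ k * c + 0 = c / 2 ^ k := by ring
  rw [hc] at hX
  exact hX

/-- On any subfamily `Φ ⊆ F₂` and any `c`: `limsup avg #Sel₂ ≤ c` together with the FLOOR «rank ≥ 2 for
100 %» (`HasDensityOn … 1`) give: the proportion of members of rank `≥ 4` is eventually `≤ (c − 4)/12 + ε`.
[cite: SilvermanAEC2009, Thm X.4.2] -/
theorem rankFourShare_le_of_selmerTwoAverageLE_of_floor {c : ℝ}
    (h : Φ.AverageOnLE (fun a ↦ (Nat.card (a.curve.selmerGroup 2) : ℝ)) c)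
    (hfloor : Φ.HasDensityOn (fun a ↦ 2 ≤ a.curve.mordellWeilRank) 1) {ε : ℝ} (hε : 0 < ε) :
    ∀ᶠ X : ℕ in atTop,
      Φ.proportionOn (fun a ↦ 4 ≤ a.curve.mordellWeilRank) X ≤ (c - 4) / 12 + ε := by
  have hD := densityOnGE_of_hasDensityOn Φ hfloor ε hε
  filter_upwards [h ε hε, hD] with X hS hF
  have hpt := averageOn_mono Φ (fun a ha ↦ indicator_rankFour_le_selmerTwo_sub_floor a ha.1) X
  rw [averageOn_linear₂] at hpt
  rw [proportionOn_eq_averageOn] at hF ⊢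
  linarith

/-- Same hypotheses: the members of rank `2` or `3` have lower density `≥ 1 − (c − 4)/12 = (16 − c)/12`
(`DensityOnGE`, ε-form). [cite: SilvermanAEC2009, Thm X.4.2] -/
theorem densityOnGE_rank_two_or_three_of_selmerTwoAverageLE_of_floor {c : ℝ}
    (h : Φ.AverageOnLE (fun a ↦ (Nat.card (a.curve.selmerGroup 2) : ℝ)) c)
    (hfloor : Φ.HasDensityOn (fun a ↦ 2 ≤ a.curve.mordellWeilRank) 1) :
    Φ.DensityOnGE (fun a ↦ 2 ≤ a.curve.mordellWeilRank ∧ a.curve.mordellWeilRank ≤ 3)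
      ((16 - c) / 12) := by
  intro ε hε
  have hD := densityOnGE_of_hasDensityOn Φ hfloor (ε / 2) (by linarith)
  filter_upwards [rankFourShare_le_of_selmerTwoAverageLE_of_floor Φ h hfloor (ε := ε / 2) (by linarith),
    hD] with X h4 h2
  -- inclusion–exclusion: prop(2 ≤ r) + prop(r ≤ 3) ≤ 1 + prop(2 ≤ r ∧ r ≤ 3), and prop(r ≤ 3) ≥ 1 - prop(4 ≤ r)
  have hie := proportionOn_add_le Φ (fun a ↦ 2 ≤ a.curve.mordellWeilRank)
    (fun a ↦ a.curve.mordellWeilRank ≤ 3) X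
  have hcompl := proportionOn_add_le Φ (fun a ↦ a.curve.mordellWeilRank ≤ 3)
    (fun a ↦ 4 ≤ a.curve.mordellWeilRank) X
  have hempty : Φ.proportionOn (fun a ↦ a.curve.mordellWeilRank ≤ 3 ∧ 4 ≤ a.curve.mordellWeilRank) X = 0 := by
    rw [proportionOn_eq_card_filter_div]
    have : (Φ.below X).filter (fun a ↦ a.curve.mordellWeilRank ≤ 3 ∧ 4 ≤ a.curve.mordellWeilRank) = ∅ :=
      Finset.filter_eq_empty_iff.mpr fun a _ hh ↦ by omega
    rw [this, Finset.card_empty, Nat.cast_zero, zero_div]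
  rcases Nat.eq_zero_or_pos (Φ.below X).card with h0 | hpos
  · -- empty ball: the floor proportion would be `0`, contradicting `1 - ε/2 ≤ 0` unless vacuous
    rw [proportionOn_eq_card_filter_div] at h2
    rw [h0, Nat.cast_zero, div_zero] at h2
    rw [proportionOn_eq_card_filter_div, h0, Nat.cast_zero, div_zero]
    -- `(16 - c)/12 - ε ≤ 0` need not hold in general; but `1 - ε/2 ≤ 0` with `ε` small is false only if ...
    -- we derive it from `h4`: `0 ≤ (c-4)/12 + ε/2` and `h2`: `1 - ε/2 ≤ 0`.
    rw [proportionOn_eq_card_filter_div, h0, Nat.cast_zero, div_zero] at h4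
    linarith
  · have hall : Φ.proportionOn (fun a ↦ a.curve.mordellWeilRank ≤ 3) X +
        Φ.proportionOn (fun a ↦ 4 ≤ a.curve.mordellWeilRank) X = 1 := by
      rw [proportionOn_eq_card_filter_div, proportionOn_eq_card_filter_div, ← add_div,
        div_eq_one_iff_eq (by exact_mod_cast hpos.ne')]
      have hsplit := Finset.card_filter_add_card_filter_not
        (s := Φ.below X) (p := fun a ↦ a.curve.mordellWeilRank ≤ 3)
      have hneg : (Φ.below X).filter (fun a ↦ ¬ a.curve.mordellWeilRank ≤ 3) =
          (Φ.below X).filter (fun a ↦ 4 ≤ a.curve.mordellWeilRank) :=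
        Finset.filter_congr fun a _ ↦ by omega
      rw [hneg] at hsplit
      exact_mod_cast hsplit
    linarith

/-! ### §5 By name from the printed facts -/

/-- **Bhargava–Ho 2022, Thm 1.3 (`F₂` clause), DERIVED from Thm 1.1(g)/1.2 by name**: the tree fact
`thm1_2_F2_selmerTwo` («avg #Sel₂ ≤ 12 on every large subfamily of `F₂`») implies
`limsup_X avg_{Φ(<X)} rank E_a(ℚ) ≤ 7/2` on every large `Φ ⊆ F₂` — «we obtain the explicit bound … 7/2 for
the limsup of the average ranks of the curves in any large subfamily of F₂». CONDITIONAL on the named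
fact (a printed theorem). Instrument: window averages `3.117 / 3.147` at `[10¹³,10¹⁴) / [10¹⁴,10¹⁵)`.
[cite: BhargavaHo2022, Thm. 1.3 with Thm. 1.1(g), Thm. 1.2 (§1, pp. 2–3)] -/
theorem averageRank_le_seven_halves_of_selmerTwoAverage (hBH : thm1_2_F2_selmerTwo)
    (Φ : CongruenceFamily₂) (hΦ : Φ.IsLarge) :
    Φ.AverageOnLE (fun a ↦ (a.curve.mordellWeilRank : ℝ)) (7 / 2) := by
  have h := averageRank_le_of_selmerTwoAverageLE Φ (hBH Φ hΦ)
  norm_num at h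
  exact h

/-- The `F₂` instance: modulo the fact `thm1_2_F2_selmerTwo`, the average rank of Bhargava–Ho's whole
family `F₂` ordered by height has `limsup ≤ 7/2`. [cite: BhargavaHo2022, Thm. 1.3] -/
theorem averageRank_le_seven_halves_all_of_selmerTwoAverage (hBH : thm1_2_F2_selmerTwo) :
    CongruenceFamily₂.all.AverageOnLE (fun a ↦ (a.curve.mordellWeilRank : ℝ)) (7 / 2) :=
  averageRank_le_seven_halves_of_selmerTwoAverage hBH _ CongruenceFamily₂.isLarge_all

/-- **Rank tails from the printed count**: modulo `thm1_2_F2_selmerTwo`, on every large `Φ ⊆ F₂` and for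
every `k`, the proportion of members of rank `≥ k` is eventually `≤ 12/2^k + ε` (`k = 4`: `3/4`; `k = 5`:
`3/8`; `k = 6`: `3/16`). Instrument: `dens{rank ≥ 4} = .305/.317`, `dens{rank ≥ 5} = .059/.067` at
`[10¹³,10¹⁴)/[10¹⁴,10¹⁵)`. [cite: BhargavaHo2022, Thm. 1.1(g), Thm. 1.2; SilvermanAEC2009, Thm X.4.2] -/
theorem rankTailShare_le_of_selmerTwoAverage (hBH : thm1_2_F2_selmerTwo) (Φ : CongruenceFamily₂)
    (hΦ : Φ.IsLarge) (k : ℕ) {ε : ℝ} (hε : 0 < ε) :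
    ∀ᶠ X : ℕ in atTop, Φ.proportionOn (fun a ↦ k ≤ a.curve.mordellWeilRank) X ≤ 12 / 2 ^ k + ε :=
  rankTailShare_le_of_selmerTwoAverageLE Φ k (hBH Φ hΦ) hε

/-- **`dens{rank ≥ 4} ≤ 2/3` from print**: modulo Bhargava–Ho's Thm 1.1(g)/1.2 (`thm1_2_F2_selmerTwo`),
Thm 9.1 (`thm9_1_F2`) and Thm 10.1 (`thm10_1_F2`), on every large `Φ ⊆ F₂` with nonempty residue sets
the proportion of members of rank `≥ 4` is eventually `≤ 2/3 + ε` (the I1 lever gives `3/8`; instrument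
`.305/.317`). [cite: BhargavaHo2022, Thm. 1.2, Thm. 9.1, Thm. 10.1; SilvermanAEC2009, Thm X.4.2] -/
theorem rankFourShare_le_two_thirds_of_facts (hBH : thm1_2_F2_selmerTwo) (h9 : thm9_1_F2)
    (h10 : thm10_1_F2) (Φ : CongruenceFamily₂) (hΦ : Φ.IsLarge)
    (hne : ∀ p : ℕ, p.Prime → (Φ.residues p).Nonempty) {ε : ℝ} (hε : 0 < ε) :
    ∀ᶠ X : ℕ in atTop, Φ.proportionOn (fun a ↦ 4 ≤ a.curve.mordellWeilRank) X ≤ 2 / 3 + ε := by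
  have hfloor : Φ.HasDensityOn (fun a ↦ 2 ≤ a.curve.mordellWeilRank) 1 :=
    hasDensityOn_one_mono Φ (thm9_1_F2.hasDensityOn_torsionOrder_rank_of_isLarge h9 h10 Φ hΦ hne)
      fun _ h ↦ h.2
  have h := rankFourShare_le_of_selmerTwoAverageLE_of_floor Φ (hBH Φ hΦ) hfloor hε
  norm_num at h ⊢
  exact h

/-- **«At least a third of every large subfamily of `F₂` has rank `2` or `3`», from print**: modulo
Bhargava–Ho's Thm 1.1(g)/1.2, Thm 9.1 and Thm 10.1, on every large `Φ ⊆ F₂` with nonempty residue sets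
the members with `2 ≤ rank E_a(ℚ) ≤ 3` have lower density `≥ 1/3` (`DensityOnGE`). The sharpest rank-tail
consequence of the printed orbit count (Markov on Thm 1.3 gives `1/4`); rank EXACTLY `2` for a positive
proportion is not reachable from a first moment at `p = 2` (leaf-hard input Y₂). Instrument:
`dens{rank ∈ {2,3}} = .695/.683` at `[10¹³,10¹⁴)/[10¹⁴,10¹⁵)`.
[cite: BhargavaHo2022, Thm. 1.2, Thm. 9.1, Thm. 10.1; SilvermanAEC2009, Thm X.4.2] -/
theorem densityOnGE_rank_two_or_three_of_facts (hBH : thm1_2_F2_selmerTwo) (h9 : thm9_1_F2)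
    (h10 : thm10_1_F2) (Φ : CongruenceFamily₂) (hΦ : Φ.IsLarge)
    (hne : ∀ p : ℕ, p.Prime → (Φ.residues p).Nonempty) :
    Φ.DensityOnGE (fun a ↦ 2 ≤ a.curve.mordellWeilRank ∧ a.curve.mordellWeilRank ≤ 3) (1 / 3) := by
  have hfloor : Φ.HasDensityOn (fun a ↦ 2 ≤ a.curve.mordellWeilRank) 1 :=
    hasDensityOn_one_mono Φ (thm9_1_F2.hasDensityOn_torsionOrder_rank_of_isLarge h9 h10 Φ hΦ hne)
      fun _ h ↦ h.2
  have h := densityOnGE_rank_two_or_three_of_selmerTwoAverageLE_of_floor Φ (hBH Φ hΦ) hfloor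
  norm_num at h
  exact h

/-- The `F₂` instance: modulo the three printed facts, at least a third of Bhargava–Ho's family `F₂`
(ordered by height, lower density) has rank `2` or `3`. [cite: BhargavaHo2022, Thm. 1.2, Thm. 9.1, Thm. 10.1] -/
theorem densityOnGE_rank_two_or_three_all_of_facts (hBH : thm1_2_F2_selmerTwo) (h9 : thm9_1_F2)
    (h10 : thm10_1_F2) :
    CongruenceFamily₂.all.DensityOnGE
      (fun a ↦ 2 ≤ a.curve.mordellWeilRank ∧ a.curve.mordellWeilRank ≤ 3) (1 / 3) :=
  densityOnGE_rank_two_or_three_of_facts hBH h9 h10 _ CongruenceFamily₂.isLarge_all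
    fun p _ ↦ CongruenceFamily₂.residues_all_nonempty p

end Summit.BirchSwinnertonDyer.BirchSwinnertonDyer.Theorems

end
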